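import Summits.QuantumFields.YangMills.Theorems.CurvatureBoostCovariance.Negative.BetaZeroTie
import Literature.MathematicalPhysics.QuantumLattice.SchwartzReIm
import HarnessLib

/-!
# `NPointIsotropy` — the one-point distribution of a tied family is `κ · dx`

Support file for crux `stmt-QuantumFields-11686` (`PencilRigidity.NPointIsotropy`), line
`complex-rotation-bandlimit` (generation 5), helper stub `onePointConst`: the DEGREE-ONE clause of
the conclusion, made unconditional through the lattice tie.

**Statement.** Assume (H1) the Riemann sums `a_k⁴ Σ_{y ∈ box 4 L_k} g(a_k y)` of every real
Schwartz `g` on `ℝ⁴` converge to `∫ g` along any `a_k > 0`, `a_k → 0`, `a_k L_k → ∞`, and (H2) the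
exact one-point formula `⟨Φ_k(g)⟩ = c_k (μ_k − m_k) · a_k⁴ Σ_y g(a_k y)` for the curvature string
of a Wilson scheme. Then for every family `S₁` TIED to the scheme (`Tie r sch S₁`) there is
`κ : ℂ` with `S₁ 1 F = κ ∫ F` for ALL complex test functions `F` of one variable.

**Route.** Put `κ_k := c_k (μ_k − m_k)` and `R_k(g) := a_k⁴ Σ_y g(a_k y)`; the tie in degree one
(every one-point test function is off-diagonal) reads `κ_k R_k(g) → S₁ 1 (g)` for every real `g`.
With a normalised bump `g₀` (`∫ g₀ = 1`), `R_k(g₀) → 1`, so `κ_k → κ := S₁ 1 (g₀)`; hence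
`κ_k R_k(g) → κ ∫ g` and `S₁ 1 (g) = κ ∫ g` on real tensors (uniqueness of limits; the integral
over `Fin 1 → ℝ⁴` is the integral over `ℝ⁴`). A complex `F` is `re F + i im F` with `re F`,
`im F` real tensors of one variable, and both sides are `ℂ`-linear. [folklore]
-/

noncomputable section

open scoped SchwartzMap
open MeasureTheory Filter Topology
open Literature.MathematicalPhysics.QuantumLattice Literature.MathematicalPhysics.AQFT
open Literature.MathematicalPhysics.QuantumFieldTheory

namespace Summit.QuantumFields.YangMills.Theorems.NPointIsotropy.ComplexRotationBandlimit

namespace OnePoint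

/-! ## Test-function bookkeeping in degree one -/

/-- A real Schwartz function on `ℝ⁴` with integral one (a normalised smooth bump). [folklore] -/
theorem exists_integral_eq_one :
    ∃ g : 𝓢(EuclideanSpace ℝ (Fin 4), ℝ), ∫ x, g x = 1 := by
  let χ : ContDiffBump (0 : EuclideanSpace ℝ (Fin 4)) := ⟨1, 2, one_pos, one_lt_two⟩
  refine ⟨(χ.hasCompactSupport_normed (μ := volume)).toSchwartzMap χ.contDiff_normed, ?_⟩
  change ∫ x, χ.normed volume x = 1
  exact χ.integral_normed

/-- A degree-one tensor of the complexification of a real `g` is `x ↦ g (x 0)`. [folklore] -/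
theorem isTensorOf_fin_one_apply {g : 𝓢(EuclideanSpace ℝ (Fin 4), ℝ)}
    {G₁ : 𝓢((Fin 1 → EuclideanSpace ℝ (Fin 4)), ℂ)} (hG : IsTensorOf G₁ fun _ => ofRealTest g)
    (x : Fin 1 → EuclideanSpace ℝ (Fin 4)) : G₁ x = (g (x 0) : ℂ) := by
  rw [hG x]
  simp only [Fin.prod_univ_one, ofRealTest_apply]

/-- The integral of a degree-one real tensor over `Fin 1 → ℝ⁴` is the integral of its factor over
`ℝ⁴` (Lebesgue measure on `Fin 1 → ℝ⁴` is the image of Lebesgue measure on `ℝ⁴`). [folklore] -/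
theorem integral_isTensorOf_fin_one {g : 𝓢(EuclideanSpace ℝ (Fin 4), ℝ)}
    {G₁ : 𝓢((Fin 1 → EuclideanSpace ℝ (Fin 4)), ℂ)} (hG : IsTensorOf G₁ fun _ => ofRealTest g) :
    ∫ x, G₁ x = ((∫ z, g z : ℝ) : ℂ) := by
  have h1 : (fun x : Fin 1 → EuclideanSpace ℝ (Fin 4) => G₁ x) = fun x =>
      ((g (MeasurableEquiv.funUnique (Fin 1) (EuclideanSpace ℝ (Fin 4)) x) : ℝ) : ℂ) :=
    funext fun x => isTensorOf_fin_one_apply hG x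
  rw [h1]
  exact ((volume_preserving_funUnique (Fin 1) (EuclideanSpace ℝ (Fin 4))).integral_comp'
    (fun z : EuclideanSpace ℝ (Fin 4) => (g z : ℂ))).trans integral_complex_ofReal

/-- Every test function of one variable `x : Fin 1 → ℝ⁴` is a test function of `x 0`. [folklore] -/
theorem exists_eq_comp_eval (F : 𝓢((Fin 1 → EuclideanSpace ℝ (Fin 4)), ℂ)) :
    ∃ F' : 𝓢(EuclideanSpace ℝ (Fin 4), ℂ), ∀ x, F x = F' (x 0) :=
  ⟨SchwartzMap.compCLMOfContinuousLinearEquiv ℂ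
      (ContinuousLinearEquiv.funUnique (Fin 1) ℝ (EuclideanSpace ℝ (Fin 4))).symm F,
    fun x => congrArg F (funext fun i => congrArg x (Subsingleton.elim i 0))⟩

/-- Decomposition of a complex one-variable test function into the degree-one real tensors of its
real and imaginary parts: `F = re F + i · im F`. [folklore] -/
theorem eq_add_I_smul {F : 𝓢((Fin 1 → EuclideanSpace ℝ (Fin 4)), ℂ)}
    {F' : 𝓢(EuclideanSpace ℝ (Fin 4), ℂ)} (hF : ∀ x, F x = F' (x 0))
    {G₁ G₂ : 𝓢((Fin 1 → EuclideanSpace ℝ (Fin 4)), ℂ)}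
    (hG₁ : IsTensorOf G₁ fun _ => ofRealTest (reTest F'))
    (hG₂ : IsTensorOf G₂ fun _ => ofRealTest (imTest F')) : F = G₁ + Complex.I • G₂ := by
  ext x
  rw [add_apply, smul_apply, smul_eq_mul, isTensorOf_fin_one_apply hG₁,
    isTensorOf_fin_one_apply hG₂, reTest_apply, imTest_apply, hF x, mul_comm]
  exact (Complex.re_add_im _).symm

end OnePoint

/-- **The one-point distribution of a tied family is `κ · dx`** (helper stub `onePointConst` of
line `complex-rotation-bandlimit`, generation 5). From (H1) convergence of the Riemann sums of real
Schwartz functions over the exploding fine boxes and (H2) the factorisation of the lattice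
one-point function of the curvature string through the Riemann sum, every family tied to the
scheme has `S₁ 1 F = κ ∫ F` for one `κ : ℂ` and all complex one-variable test functions `F`.
[folklore] -/
theorem onePointConst : (∀ (g : SchwartzMap (EuclideanSpace ℝ (Fin 4)) ℝ) (a : ℕ → ℝ) (L : ℕ → ℕ), (∀ k, 0 < a k) → Filter.Tendsto a Filter.atTop (nhds 0) → Filter.Tendsto (fun k => a k * L k) Filter.atTop Filter.atTop → Filter.Tendsto (fun k => a k ^ 4 * ∑ y ∈ Literature.Probability.LatticeModels.box 4 (L k), g (a k • Literature.MathematicalPhysics.QuantumLattice.siteToE y)) Filter.atTop (nhds (∫ x, g x))) → ∀ (G : Type) [Group G] [TopologicalSpace G] [IsTopologicalGroup G] [CompactSpace G] [MeasurableSpace G] [BorelSpace G] (r : Literature.MathematicalPhysics.QuantumFieldTheory.LatticeRep G) (sch : Literature.MathematicalPhysics.QuantumFieldTheory.SpeciesScheme (Literature.MathematicalPhysics.QuantumFieldTheory.YMSpecies G)) (S₁ : Literature.MathematicalPhysics.QuantumLattice.SchwingerFamily (EuclideanSpace ℝ (Fin 4))), (∀ k : ℕ, ∃ μ : ℝ,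 ∀ g : SchwartzMap (EuclideanSpace ℝ (Fin 4)) ℝ, Literature.MathematicalPhysics.QuantumFieldTheory.latticeSchwinger r.ρ sch (fun s => s.F) k 1 (fun _ => r.curvature) (fun _ => g) = sch.c r.curvature k * (μ - sch.m r.curvature k) * (sch.a k ^ 4 * ∑ y ∈ Literature.Probability.LatticeModels.box 4 (sch.L k), g (sch.a k • Literature.MathematicalPhysics.QuantumLattice.siteToE y))) → Summit.QuantumFields.YangMills.Theorems.CurvatureBoostCovariance.Negative.Tie r sch S₁ → ∃ κ : ℂ, ∀ F : SchwartzMap (Fin 1 → EuclideanSpace ℝ (Fin 4)) ℂ, S₁ 1 F = κ * ∫ x, F x := by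
  intro hRiem G _ _ _ _ _ _ r sch S₁ hfac htie
  -- the Riemann sums `R k g` and the constants `κs k = c_k (μ_k - m_k)` of the scheme
  obtain ⟨R, hR_def⟩ : ∃ R : ℕ → 𝓢(EuclideanSpace ℝ (Fin 4), ℝ) → ℝ, R = fun k g =>
      sch.a k ^ 4 * ∑ y ∈ Literature.Probability.LatticeModels.box 4 (sch.L k),
        g (sch.a k • siteToE y) := ⟨_, rfl⟩
  have hR : ∀ g : 𝓢(EuclideanSpace ℝ (Fin 4), ℝ), Tendsto (fun k => R k g) atTop (𝓝 (∫ x, g x)) :=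
    fun g => by
    rw [hR_def]
    exact hRiem g sch.a sch.L sch.a_pos sch.tendsto_a sch.tendsto_L
  choose μ hμ using hfac
  obtain ⟨κs, hκs_def⟩ : ∃ κs : ℕ → ℝ, κs = fun k =>
      sch.c r.curvature k * (μ k - sch.m r.curvature k) := ⟨_, rfl⟩
  have hfacR : ∀ (k : ℕ) (g : 𝓢(EuclideanSpace ℝ (Fin 4), ℝ)),
      latticeSchwinger r.ρ sch (fun s => s.F) k 1 (fun _ => r.curvature) (fun _ => g) =
        κs k * R k g := fun k g => by
    rw [hκs_def, hR_def]
    exact hμ k g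
  -- the tie in degree one, read through the factorisation
  have htie1 : ∀ (g : 𝓢(EuclideanSpace ℝ (Fin 4), ℝ))
      (G₁ : 𝓢((Fin 1 → EuclideanSpace ℝ (Fin 4)), ℂ)), IsTensorOf G₁ (fun _ => ofRealTest g) →
      Tendsto (fun k => (κs k : ℂ) * (R k g : ℂ)) atTop (𝓝 (S₁ 1 G₁)) := fun g G₁ hG₁ =>
    (htie 1 one_ne_zero (fun _ => g) G₁ hG₁
      (HypercubicLimit.Negative.isOffDiagonal_fin_one G₁)).congr
      fun k => by rw [hfacR k g, Complex.ofReal_mul]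
  have hofR : ∀ g : 𝓢(EuclideanSpace ℝ (Fin 4), ℝ),
      Tendsto (fun k => (R k g : ℂ)) atTop (𝓝 ((∫ x, g x : ℝ) : ℂ)) := fun g => (hR g).ofReal
  -- the constants converge: test against a normalised bump
  obtain ⟨g₀, hg₀⟩ := OnePoint.exists_integral_eq_one
  obtain ⟨G₀, hG₀⟩ := exists_isTensorOf (fun _ : Fin 1 => ofRealTest g₀)
  have hκ : Tendsto (fun k => (κs k : ℂ)) atTop (𝓝 (S₁ 1 G₀)) := by
    have h1 : Tendsto (fun k => (R k g₀ : ℂ)) atTop (𝓝 1) := by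
      have h := hofR g₀
      rwa [hg₀, Complex.ofReal_one] at h
    refine (Filter.tendsto_mul_iff_of_ne_zero h1 one_ne_zero).1 ?_
    rw [mul_one]
    exact htie1 g₀ G₀ hG₀
  -- the value on real tensors
  have hreal : ∀ (g : 𝓢(EuclideanSpace ℝ (Fin 4), ℝ))
      (G₁ : 𝓢((Fin 1 → EuclideanSpace ℝ (Fin 4)), ℂ)), IsTensorOf G₁ (fun _ => ofRealTest g) →
      S₁ 1 G₁ = S₁ 1 G₀ * ∫ x, G₁ x := fun g G₁ hG₁ => by
    rw [OnePoint.integral_isTensorOf_fin_one hG₁]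
    exact tendsto_nhds_unique (htie1 g G₁ hG₁) (hκ.mul (hofR g))
  -- extension to all complex test functions by linearity
  refine ⟨S₁ 1 G₀, fun F => ?_⟩
  obtain ⟨F', hF'⟩ := OnePoint.exists_eq_comp_eval F
  obtain ⟨G₁, hG₁⟩ := exists_isTensorOf (fun _ : Fin 1 => ofRealTest (reTest F'))
  obtain ⟨G₂, hG₂⟩ := exists_isTensorOf (fun _ : Fin 1 => ofRealTest (imTest F'))
  haveI : (volume : Measure (Fin 1 → EuclideanSpace ℝ (Fin 4))).HasTemperateGrowth :=
    Measure.IsAddHaarMeasure.instHasTemperateGrowth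
  rw [OnePoint.eq_add_I_smul hF' hG₁ hG₂, map_add, map_smul, smul_eq_mul, hreal _ G₁ hG₁,
    hreal _ G₂ hG₂]
  simp only [add_apply, smul_apply, smul_eq_mul]
  rw [integral_add G₁.integrable (G₂.integrable.const_mul _), integral_const_mul]
  ring

end Summit.QuantumFields.YangMills.Theorems.NPointIsotropy.ComplexRotationBandlimit

end
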